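import Summits.BirchSwinnertonDyer.BirchSwinnertonDyer.Theorems.EisensteinPrimesMazurMCOnX1RankZeroInterludeCoreDescentXI0
import Summits.BirchSwinnertonDyer.BirchSwinnertonDyer.Theorems.EisensteinPrimesMazurMCOnX1RankZeroInterludeStubRoadBResidueP
import Summits.BirchSwinnertonDyer.BirchSwinnertonDyer.Theorems.EisensteinPrimesMazurMCOnX1RankZeroInterludeResidualGL1Tame
import Summits.BirchSwinnertonDyer.BirchSwinnertonDyer.Theorems.EisensteinPrimesMazurMCOnX1RankZeroInterludeRoadBGL1Reduction
import Summits.BirchSwinnertonDyer.BirchSwinnertonDyer.Theorems.EisensteinPrimesMazurMCOnX1RankZeroInterludeResidualGL1Unr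
import Summits.BirchSwinnertonDyer.BirchSwinnertonDyer.Theorems.EisensteinPrimesMazurMCOnX1RankZeroInterludeResidualGL1Even
import Literature.NumberTheory.IwasawaTheory.GreenbergLemma59OfFerreroWashington
import Literature.NumberTheory.IwasawaTheory.ClassicalMuVanishesUnramifiedClassesProofs
import HarnessLib

/-!
# Line `interlude_with_torsion` — crux 5 `MazurMCOnX1RankZero` (stmt-BirchSwinnertonDyer-19035) — skeleton v14

v14 (CANDIDATE written by the prover seat bsd-eis-lam-a g21, 2026-08-29, for the LEAD's ONE touch of this line under the RESTUB SHAPE OF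
RECORD (director-bsd (390)(1)–(3), VARIANT-N); NOT registered by its author — only the crux LEAD / route tenure planner runs
`ledger skeleton check`). TWO THINGS CHANGE, NOTHING ELSE. (1) `stub_publishedL59` (Greenberg, LNM 1716, §5 Lemma 5.9, even finiteness
clause) LEAVES THE STUB LIST: it is now a TREE THEOREM MODULO FERRERO–WASHINGTON,
`IwasawaTheory.greenberg1999_lemma59_even_finite_of_ferreroWashington` (`Literature/NumberTheory/IwasawaTheory/GreenbergLemma59OfFerreroWashington.lean`,
p717721, seat lam-a g20: Greenberg's own proof pp. 143–144 — the kernel `N = ker θ ∩ ker ω`, Kummer theory and reflection at the CM layers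
`ℚ(θ, μ_p)·ℚ_n`, at most `[ℚ(θ, μ_p) : ℚ]` primes above `p`, linear growth of `ord_p h` from FW), so [Even] is fed in-file by
`publishedL59_closed`. (2) The second conjunct of v11–v13's `stub_publishedFW`, Iwasawa's «`μ = 0` ⟹ finitely many everywhere-unramified
classes» (`IwasawaTheory.classicalMuVanishes_finite_unramifiedClasses`), is a TREE THEOREM (`…_holds`, p694611 + exact-name alias), so the
print input of road B is FERRERO–WASHINGTON ALONE, and by VARIANT-N (i) ALL print facts the line needs are the conjuncts of ONE cite stub:
**`stub_printInputs : (PublishedFacts ∧ PublishedFactsII ∧ CGS Prop. 3.4.2 ∧ KO Prop. 2.9) ∧ FW`** [CITE-ONLY — never a proof target, never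
benched]; its first conjunct is v8–v13's `stub_publishedAll` token for token, its second is conjunct 1 of v11–v13's `stub_publishedFW`.
STUBS v14 (3 sorries): `stub_printInputs` (PURE-CITE: PUB ×15 ∧ Ferrero–Washington) · `stub_goodLatticeBDPValue` (CROSS-CRUX ≡ crux 2,
token-identical to v7–v13) · `stub_crossTransferSomeLattice` (CONTENT, XI°, token-identical to v13). In-file `_closed` theorems by name:
`publishedAll_closed`, `publishedFW_closed` (FW ∧ U), `publishedL59_closed`, `gl1InputUnramified_of_stubs`, `greenbergEvenInput_of_stubs`,
`residualGL1FinitenessOdd_of_stubs`, `stub_roadBResidueP`; composition `MazurMCOnX1RankZero_of` unchanged in shape. By-name accounting: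
**crux 5 ⟸ PUB ×16 (15 research-refereed + Ferrero–Washington) ∧ crux 2 ∧ XI° (PRE)** — after this touch the line reads «1 cite + 1 CONTENT +
crux 2» (host g34 RESTUB MAP 13:12:37Z). No summit statement (BSD, Mazur's MC, IMC2), no crux is proved. The v13–v10 paragraphs follow.

(v13)
v13 (LEAD cruxlead-19035 g0, 2026-08-29, same session): THE PRE DOOR IS RE-WORDED TO THE WEAKER, STATEMENT-LEVEL FORM. v8–v12's
`stub_fourTermSomeLattice : PublishedFacts → PublishedFactsII → FourTermAtSomeLattice` (XI″ = the two four-term identities of the PROOF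
of CGS Prop. 4.2.1 at `α = 𝟙`) was used by the composition only through the tree's elimination `crossTransferSome_of_fourTermSome`; v13
registers instead **`stub_crossTransferSomeLattice : PublishedFacts → PublishedFactsII → CrossTransferAtSomeLattice`** (XI° = the two
divisibility transfers of CGS Prop. 4.2.1 ITSELF at `α = 𝟙` at some member of the class, no `K`-torsion hypothesis — tree def
`…Theorems.InterludeWithTorsion.CrossTransferAtSomeLattice`, p685554), and composes through the tree theorem
`mazurMCOnX1RankZero_of_stubs_xi0` (`Theorems/…InterludeCoreDescentXI0.lean`: crux 5 BY NAME from the v13 stub types; its lemma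
`xi0Door_of_fourTermDoor` records XI″ ⟹ XI°). WHY: the promoted atom should be the WEAKEST statement the line consumes and the one print
STATES (Prop. 4.2.1), so that it can be discharged BY NAME by a typed (PRE-flagged) Literature statement of `prop:equiv` or by any other road
to the transfers (e.g. the ideator g18's `kato-discriminant` card, which avoids the reciprocity laws); XI″ remains a sufficient door.
STUBS v13 (5 sorries): `stub_publishedAll` (PUB ×15) · `stub_publishedFW` (PUB ×2) · `stub_publishedL59` (PUB ×1) · `stub_goodLatticeBDPValue`
(crux 2) — all four token-identical to v12 — · `stub_crossTransferSomeLattice` (XI°, RE-WORDED from XI″). By-name accounting unchanged in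
shape: **crux 5 ⟸ PUB ×18 ∧ crux 2 ∧ XI° (PRE: `prop:equiv` ⇐ Cor. 4.1.3 ⇐ Thm. 4.1.1 ⇐ BSTW24 §5)**. No summit statement (BSD, Mazur's MC,
IMC2), no crux is proved. The v12/v11/v10 paragraphs follow.

(v12)
v12 (LEAD cruxlead-19035 g0, 2026-08-29, same session): ROAD B IS FULLY PUB-BY-NAME. The last research-shaped road-B stub of v11,
`stub_greenbergEvenInput` ([Even] = Greenberg, LNM 1716, §5 Lemma 5.9 read over `K_∞ ⊃ ℚ_∞`), is DISCHARGED to the PUBLISHED named fact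
`IwasawaTheory.greenberg1999_lemma59_even_finite` (Greenberg's Lemma 5.9 over `ℚ_∞`, statement-only Literature file
`Literature/NumberTheory/IwasawaTheory/GreenbergCyclicOrderP.lean`, p693821) by the TREE theorem `EvenTransport.greenbergEvenInput_of_lemma59`
(`Theorems/…InterludeResidualGL1Even{IndexTwo,Core,Twist,}.lean`; mathematics by the ideator bsd-idea-11 g17: the index-2 pair
`res(ker κ_K) ⊲ ker κ_ℚ`, transport of `H¹`, corestriction, the quadratic twist `M ⊗ ε_K`, complex conjugation acting by `±1`).
STUBS v12 (5 sorries): `stub_publishedAll` (PUB ×15) · `stub_publishedFW` (PUB ×2) · `stub_publishedL59` (PUB ×1, NEW) · `stub_goodLatticeBDPValue`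
(crux 2) · `stub_fourTermSomeLattice` (XI″, the PRE atom) — the first two and last two token-identical to v11. By-name accounting:
**crux 5 ⟸ PUB ×18 ∧ crux 2 ∧ XI″ (PRE)** — the Interlude line's only research-shaped doors are the route's crux 2 and the CGS §4 PRE atom.
No summit statement (BSD, Mazur's MC, IMC2), no crux is proved. The v11/v10 paragraphs follow.

(v11)
v11 (LEAD cruxlead-19035 g0, 2026-08-29, same session): road B's input [Unr] (`stub_gl1InputUnramified` of v10) is DISCHARGED to two
REFEREED NAMED FACTS — Ferrero–Washington (`IwasawaTheory.ferreroWashington1979_classicalMuVanishes`, μ = 0 for the cyclotomic tower of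
every abelian number field) and Iwasawa's `μ = 0 ⟹ finitely many everywhere-unramified classes` (`IwasawaTheory.classicalMuVanishes_finite_unramifiedClasses`)
— by the TREE theorem `UnrTransport.gl1InputUnramified_of_ferreroWashington` (`Theorems/…InterludeResidualGL1Unr{Transport,}.lean`, p692713 +
p692956; mathematics by the ideator bsd-idea-11 g17: the trivialising ABELIAN field `F = K·ℚ(η)`, `p ∤ [F:K]`, restriction of `κ`, transport
of unramified classes with finite fibres). The two named facts join the PUB stubs as `stub_publishedFW` (token list below). STUBS v11 (5 sorries):
`stub_publishedAll` (PUB ×15) · `stub_publishedFW` (PUB ×2, NEW) · `stub_goodLatticeBDPValue` (crux 2) · `stub_fourTermSomeLattice` (XI″) ·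
`stub_greenbergEvenInput` ([Even]) — the first, third, fourth and fifth token-identical to v10; LEAVES `stub_gl1InputUnramified` (CLOSED modulo PUB,
in-file `gl1InputUnramified_of_stubs`). By-name accounting: crux 5 ⟸ PUB ×17 ∧ crux 2 ∧ XI″ (PRE) ∧ [Even] (Greenberg LNM 1716 Lemma 5.9 over
`K_∞`). The v10 paragraph follows.

(v10)
v10 (LEAD cruxlead-19035 g0, 2026-08-29, same session as v8/v9). TWO THINGS CHANGE. (1) The skeleton is now SLIM: every currency of
the line is a TREE DEFINITION (`Theorems/…InterludeDefs.lean`, p685554) and the whole sorry-free recomposition is a chain of TREE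
THEOREMS ending in `…Theorems.InterludeWithTorsion.mazurMCOnX1RankZero_of_stubs` (`Theorems/…InterludeCoreDescent.lean`, p686428:
crux 5 BY NAME from the five v8 stub types), so this file only declares the STUBS (read over the tree defs — a Theorems file
`theorem stub_X : <same text>` closes a stub BY NAME) and the composition. (2) ROAD B's last input (B3) `ResidualGL1FinitenessOdd` is
SPLIT along the reduction landed by this lead's stub-worker W2 (`Theorems/…InterludeResidualGL1{OuterConj,Swap,Finiteness,Continuity,Tame}.lean`,
p688042/p688485/p689081/p689538/p690082: Greenberg's complex-conjugation SWAP `T_τ = cycSwapH1` maps `Sel_{v̄-str}` into `Sel_{v-str}`,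
their intersection is everywhere-unramified, the tame places are a THEOREM for every order-`p` module, non-continuous actions have
`H¹ = 0`): `residualGL1FinitenessOdd_of_unr_even' : [Unr] → [Even] → ResidualGL1FinitenessOdd`, where
[Unr] = Ferrero–Washington in CHARACTER form for the abelian field `K·ℚ(η)` (everywhere-unramified classes of `H¹(K_∞, M)` finite;
tree node `RoadBHelpers.GL1InputUnramified` of `Theorems/…InterludeRoadBGL1Reduction.lean`, p689882 — the ideator bsd-idea-11 g16's [P1])
and [Even] = Greenberg, LNM 1716, **Lemma 5.9** («for `p` odd and `Θ` even, `H¹(ℚ_Σ/ℚ_∞, Θ)` is finite») read over `K_∞ ⊃ ℚ_∞` through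
the `±`-parts of `T_c` (index-`2` inflation–restriction): BOTH PRINTED THEOREMS modulo class-field-theoretic plumbing not in the tree.
STUBS v10 (5 sorries): `stub_publishedAll` (PUB ×15) · `stub_goodLatticeBDPValue` (crux 2) · `stub_fourTermSomeLattice` (XI″, PRE atom)
[all three token-identical to v8/v9] · `stub_gl1InputUnramified : RoadBHelpers.GL1InputUnramified` ([Unr], NEW, print-assembly: F–W)
· `stub_greenbergEvenInput` ([Even], NEW, print-assembly: Greenberg Lemma 5.9). LEAVES: `stub_residualGL1FinitenessOdd` (SPLIT into
[Unr] ∧ [Even]: `residualGL1FinitenessOdd_of_stubs` below, sorry-free over the tree). CLOSED (tree theorems): `stub_roadBResidueP`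
((B1c)@p, p687195), K2⁺-e, road B (B0)(B1)(B2)(ℓ≠p), [Tame], frame/S1⁺⊕GV/XI-elimination/ISO/core/descent. By-name accounting:
crux 5 ⟸ PUB ×15 ∧ crux 2 ∧ XI″ (PRE) ∧ F–W-for-`K·ℚ(η)` ∧ Greenberg-Lemma-5.9-over-`K_∞`. The ideator's alternative split of (B3)
([P1]-cont ∧ [Cv]-cont, Brumer–Leopoldt chain; `Theorems/…InterludeRoadBGL1{Reduction,Continuous}.lean`) and the 4-hypothesis closure
over `ResidualGL1FinitenessOddCont` (`Theorems/…InterludeCoreDescentCont.lean`) are in the tree as well. No summit statement (BSD,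
Mazur's MC, IMC2), no crux and no stub is proved by this file.

HISTORY (v8/v9 docstring, kept verbatim below).


# Line `interlude_with_torsion` — crux 5 `MazurMCOnX1RankZero` (stmt-BirchSwinnertonDyer-19035) — skeleton v8

v9 (LEAD cruxlead-19035 g0, 2026-08-29, same session as v8): `stub_roadBResidueP` (road B (B1c) at degree exactly `p`) is CLOSED — a
THEOREM OF THE TREE given (B3) as registered (`Theorems/…InterludeStubRoadBResidueP.lean` p687195, stub credit by name; proof
`Theorems/…InterludeRoadBResidueP{KernelModule,}.lean` p686588/p687054, the ideator bsd-idea-11 g16's companion §Cohomology…§Core moved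
into the tree by this lead's wave). Sorries 5 → 4 = {`stub_publishedAll` (PUB ×15), `stub_goodLatticeBDPValue` (crux 2),
`stub_fourTermSomeLattice` (XI″, PRE atom), `stub_residualGL1FinitenessOdd` ((B3), print-assembly: Ferrero–Washington + Brumer–Leopoldt +
Iwasawa; decomposed [P1]/[Cv]/[P23] in the companion §GL1Reduction)}; every other declaration token-identical to v8. In parallel the
whole recomposition is being moved into `Theorems/` over the tree Defs `…InterludeDefs` (p685554): `…InterludeFramePlusChar` (p686187),
`…InterludeTransfersIso` (p686250), `…InterludeCoreDescent` (pending) — whose last theorem `mazurMCOnX1RankZero_of_stubs` is crux 5 BY NAME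
CONDITIONAL on exactly the registered stub types.

v8 (LEAD cruxlead-19035 g0, 2026-08-29; successor of LEAD bsd-line-x1-p2 g3, whose v7 = sha `b839abcf7c47adeb…` was the
skeleton of record with ONE open non-PUB stub `stub_stepsTwoThree : PublishedFacts → CGS Prop. 3.4.2 → MinusLineValueClass →
InterludeNodeAnom`, size L, verdict «promote-stub»). v8 FOLDS INTO THE LINE OF RECORD the nearmiss split of exactly that stub
built by the ideator bsd-idea-11 (g6–g16) in the supplement workfile `Lines/interlude_stepsTwoThree_split_idea11g6.lean`
(REV 8.5, commit 11a4c1684aae, farm rc 0, sorries 4 = its stubs) — every typed piece, every proof and every docstring of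
the split below is that seat's work, carried VERBATIM unless marked «v8» — and moves its sorry-free infrastructure into the
tree as `Theorems/` helpers so that the remaining stubs are closable BY NAME from importable files:
`…InterludeSelmerIsogenyMaps` (p683307: `K2e.acSelmerMap`, transposes), `…InterludeSelmerIsogenyKernels` (K2e (D),
finite-kernel lemmas, **K2⁺-e PROVED**: `xGrIsogenyInvariantAwayFromP`), `…InterludeMuMonotone` (road B (B1)),
`…InterludeCyclicIsogenyPrimeStep` (p683847, road B (B2)), `…InterludeRoadBReduction` (road B assembled:
`xGrMuIsogenyInvariantCyc_of_kerSelmerMapFiniteOfDegreeP`, `xGrCharIdealIsogenyInvariantCyc_of_kerSelmerMapFiniteOfDegreeP`).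

STUBS OF v8 (five `sorry`s, nowhere else; `MazurMCOnX1RankZero_of` concludes the crux BY NAME):
* `stub_publishedAll` · PUB · v7's `PublishedFacts` (×11) ∧ `PublishedFactsII` (Yan–Zhu Thm. 3.9/Def. 3.11, Prop. 3.14
  guarded) ∧ CGS Prop. 3.4.2 (v7's `stub_twoLineEulerChar`, p615412) ∧ Kobayashi–Ota Prop. 2.9 (v7's `stub_isogenyGrAc`,
  p623352) — refereed named facts BY NAME, discharged only by `_holds` theorems (v7's three PUB stubs re-bundled, + PUB-II).
* `stub_goodLatticeBDPValue` · the route's crux 2 BY NAME (token-identical to v7; SAME WALL, declared).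
* `stub_fourTermSomeLattice` · M/L, the PRE ATOM XI″ · `PublishedFacts → PublishedFactsII → FourTermAtSomeLattice`: the two
  four-term identities of the PROOF of CGS Prop. 4.2.1 (`prop:equiv`) at `α = 𝟙` at SOME member of the class (print: Wüthrich's
  `E_•`), the compact `𝔖_{str,rel}`, `𝔖_ord` killed by [TF] (Kato, Astérisque 295 §13.8) instead of `E_•(K)[p] = 0`; PRE only
  through the rider `prop:equiv` ⇐ Cor. 4.1.3 ⇐ Thm. 4.1.1 ⇐ BSTW24 §5 (flag `CGS25-BST-Thm311`). Beilinson–Flach classes,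
  Coleman maps and the two explicit reciprocity laws live INSIDE this one stub; its carriers `NodeHyp`/`FrameData` are
  structures of this file (a `Theorems/…Defs` file is owed before a Theorems-side closure).
* `stub_residualGL1FinitenessOdd` · M · road B (B3) · `ResidualGL1FinitenessOdd`: the residual Greenberg Selmer group of an
  ORDER-`p` module with `Γ_ℚ`-provenance over the CYCLOTOMIC `ℤ_p`-extension of an imaginary quadratic `K` (`p = v v̄` odd;
  no condition above `v` and at `S`, zero above `v̄`) is FINITE — Ferrero–Washington for the abelian field `K·ℚ(η)`, Kummer
  duality / the unit module `𝒰_∞/Ē_∞` of `(Kℚ(η))⁺` torsion with `μ = 0`, Leopoldt for abelian fields (Brumer) along the tower;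
  NOT in print in this form (presearch: idea-11 memo §9; this lead, NOTES) — nearest: Greenberg LNM 1716 Prop. 5.10 (over
  `ℚ_∞`), CGLS22 Prop. 14 (anticyclotomic, tree fact `prop14_residualCharacterSelmer_finite`, proviso `θ|_{G_v̄} ≠ 1, ω`).
* `stub_roadBResidueP` · M · road B (B1c) at degree EXACTLY `p` · `RoadBResidueP := ResidualGL1FinitenessOdd →
  KerSelmerMapFiniteOfDegreeP`: along ONE `ℚ`-isogeny `ψ₀ : W → W'` of degree `p` between good-at-`p` curves, the Selmer map
  `Sel_v̄(K_∞⁺, ψ₀/K)` (`K2e.acSelmerMap`, tree) has FINITE kernel — `ker ⊆ ι_* R♯(W[ψ₀])`, `R♯/R ↪` the finite local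
  discrepancy above `v̄` (idea-11 memo §10 (R1)–(R6); input-free algebra (R3)/CL already sorry-free in the companion workfile
  `Lines/interlude_stepsTwoThree_split_idea11g6_roadB_helpers.lean`).
CLOSED (no `sorry`): `stub_minusClassValue` (v7, p623964) · K2⁺-e (`xGrIsogenyAwayFromP_holds`, tree theorem) · K2⁺-μ and
K2⁺ from the two road-B stubs (`xGrMuIsogenyInvariantCyc_of_stubs`, `xGrIsogenyInvariantCyc_of_stubs`, tree theorems of
`…InterludeRoadBReduction`) · frame existence, S1⁺ ⊕ GV, XI-elimination, ISO, Steps 2–3 core, the descent `K_∞⁺ → ℚ_∞`.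
What leaves the skeleton (v7 → v8): `stub_published`, `stub_twoLineEulerChar`, `stub_isogenyGrAc` (re-bundled into
`stub_publishedAll`), `stub_stepsTwoThree` (SPLIT: = `stepsTwoThree_of_stubs`, sorry-free below, from the five stubs).
T0/T1 honesty (idea-11, rev 5): all 149 X1 `K`-rows have the same shape — XI″ at `E_•` = print ⊕ [TF] ⊕ PRE rider, and K2⁺;
on the 26 T0 rows K2⁺ is avoidable in-file (`stepsTwoThree_of_pieces` with `V = E_•`). No summit statement (BSD, Mazur's
MC, IMC2), no crux and no stub is proved by this file; what is kernel-checked is the recomposition and the pieces marked PROVED.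

THE LINE (v7 text, LEAD x1-p2). Castella–Grossi–Skinner, *Math. Ann.* 393 (2025), §5 "Interlude: the rank one case" runs
THREE steps from the anticyclotomic main conjecture with its BDP value (their input (5.1)) to Mazur's main conjecture over `ℚ`:
Step 1, the TWO-LINE EULER CHARACTERISTIC (Prop. 3.4.2); Step 2, Kato–Wuthrich for `E_•`, `E_•^K` + two-variable descent
Prop. 2.2.4 + Shapiro Prop. 3.3.1 + `prop:equiv` (Prop. 4.2.1, Greenberg ⟺ ordinary Selmer on `K_∞⁺`, from the explicit
reciprocity law Thm. 4.1.1 ⇐ [BSTW24, §5]); Step 3, equality of constant terms + Skinner–Urban [SU14, Lemma 3.2] ⟹ equality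
of ideals, then descent to `ℚ_∞`. The printed Interlude assumes `E(K)[p] = 0` and `φ|_{G_p} ≠ 𝟙, ω`, i.e. EXACTLY what fails
on class X1; input (5.1) at the anomalous good lattice IS the route's crux 2 `GoodLatticeBDPValue`. For a rank-`0` X1 pair
`(E, p)` the auxiliary `K` is a Bump–Friedberg–Hoffstein field, `rank E(K) = 1`, `Ш(E/K)[p^∞] < ∞` by Gross–Zagier–Kolyvagin,
and the `K_∞⁺`-level main conjecture descends to `ℚ_∞` as in the tree's `thmA_of_thm723` (kernel-checked below).
THE CUT (idea-11 rev 5; CGS25 §5, TeX l. 2100–2131 — Step 1 at the good lattice `E₀`, Steps 2–3 at a member `V ∼ E`, print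
`V = E_•`): FINDING — no new object has to be TYPED to state the pieces of §5: `X_Gr(E/K_∞⁺)` = `AcSelmer.XAc (E.baseChange K)
p κ v̄ ∅ γ₁` at the CYCLOTOMIC `κ`, `X_ord(E/K_∞⁺)` = `SelmerDualData κ γ`, `𝓛_p^Gr(f/K)⁺` = `UnrSeries₂.plus G` of a Yan–Zhu /
CGS Greenberg frame, `Λ ↪ Λ^ur` = `Ideal.map (PowerSeries.map J)`, `𝓛_p^PR(E/K)⁺` = `ϖϖ'·L_p(f,α)L_p(g,α')`.
Long forms of every compressed docstring: the card `Lines/interlude_stepsTwoThree_split_idea11g6.md` and the memos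
`Lines/interlude_K2mu_ArnoldKoo_memo_idea11g14.md` (Appendices A–I), `Lines/interlude_K2mu_Drinen_typing_memo_idea11g12.md`;
v2–v7 history: `Lines/interlude_with_torsion-REPORT.md`, `-F123.md` (LEAD x1-p2).
PRE RIDER (displayed, never folded into "print"): `prop:equiv` ⇐ CGS Cor. 4.1.3 ⇐ Thm. 4.1.1 ⇐ Burungale–Skinner–Tian–Wan,
arXiv:2409.01350 §5 (preprint); cell flag `CGS25-BST-Thm311`.
[cite: CastellaGrossiSkinner2025, §5 (Interlude), Prop. 4.2.1 (proof, l. 1896–1941), Cor. 4.1.3, Prop. 2.4.5, Prop. 3.3.1, Prop. 3.2.3, Prop. 3.4.2]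
[cite: YanZhu2024MainConjNonCM, Thm. 3.9, Def. 3.11, Prop. 3.14, Cor. 5.4] [cite: SkinnerUrban2014, Lemma 3.2]
[cite: Wuthrich2014, Thm. 16] [cite: BurungaleSkinnerTianWan2024, §5] [cite: Kato2004Asterisque, §13.8, Thm. 12.4]
[cite: KellerYin2024, Thm. 3.0.8] [cite: KobayashiOta2020, Prop. 2.9, footnote 1 (p. 552)] [cite: GreenbergLNM1716, §1, §5 Prop. 5.10]
[cite: FerreroWashington1979, Theorem] [cite: PerrinRiou1989ASPM, Théorème (p. 349)] [cite: BumpFriedbergHoffstein1990, Theorem]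
-/

set_option linter.dupNamespace false
set_option autoImplicit false

noncomputable section

open scoped Classical

open WeierstrassCurve NumberField IsDedekindDomain Field Literature.NumberTheory
  Literature.NumberTheory.EllipticCurves Literature.NumberTheory.GaloisRepresentations
  Literature.NumberTheory.EllipticCurves.GreenbergSelmer Literature.NumberTheory.EllipticCurves.GreenbergVatsal2000
  Literature.NumberTheory.EllipticCurves.Rank1Residual Literature.NumberTheory.EllipticCurves.Castella2018
  Literature.NumberTheory.QuadraticFields
  Summit.BirchSwinnertonDyer.BirchSwinnertonDyer.Theorems.InterludeWithTorsion

namespace Summit.BirchSwinnertonDyer.BirchSwinnertonDyer.Cruxes.MazurMCOnX1RankZero.InterludeWithTorsion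

/-! ## The stubs (all currencies are tree definitions of `Theorems/…InterludeDefs.lean` / `…InterludeRoadBGL1Reduction.lean`) -/

/-- `stub_printInputs` · **[CITE-ONLY — never a proof target, never benched]** (VARIANT-N (i), v14) · ALL the print facts the line
consumes, as ONE conjunction of the tree's cite-tagged `Prop`s BY NAME: FIRST CONJUNCT = v8–v13's `stub_publishedAll` token for token —
v7's `PublishedFacts` (×11: BFH, modular parametrisation, newform, rank = analytic rank ≤ 1, CGS Prop. 3.3.1 / Prop. 3.2.3 / Thm. 2.4.2 +
Lemma 2.4.4 / Thm. 2.4.1, Wuthrich 2014 Thm. 16, CGLS 2022 Thm. 5.1.1 / Thm. 5.1.3), `PublishedFactsII` (×2: Yan–Zhu Thm. 3.9 / Prop. 3.14),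
CGS Prop. 3.4.2 (p615412) and Kobayashi–Ota Prop. 2.9 (p623352); SECOND CONJUNCT = FERRERO–WASHINGTON (Ann. of Math. 109 (1979): `μ = 0` for
the cyclotomic `ℤ_p`-extension of every ABELIAN number field; tree `IwasawaTheory.ferreroWashington1979_classicalMuVanishes`, size XL, the ONE
print input of road B after v14). Refereed statements typed as `def … : Prop`; discharged only by `_holds` theorems.
[cite: Wuthrich2014, Thm. 16] [cite: CastellaGrossiSkinner2025, Prop. 3.3.1, Prop. 3.4.2, Thm. 2.4.2, Prop. 2.4.5]
[cite: KobayashiOta2020, Prop. 2.9] [cite: YanZhu2024MainConjNonCM, Thm. 3.9, Prop. 3.14] [cite: FerreroWashington1979, Theorem]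
[cite: Washington1997, §7.5 Thm. 7.15] -/
theorem stub_printInputs :
    (PublishedFacts ∧ PublishedFactsII ∧
      CastellaGrossiSkinner2025.prop342_twoLineEulerChar_trivialChar ∧
      KobayashiOta2020.prop29_charIdeal_XGr_anticyclotomic_eq_of_isIsogenous) ∧
    IwasawaTheory.ferreroWashington1979_classicalMuVanishes := by
  sorry

/-! ### The v8–v13 PUB stubs, CLOSED in-file from `stub_printInputs` (VARIANT-N (ii): `…_closed` theorems by name) -/

/-- v8–v13's `stub_publishedAll` (PUB ×15), token-identical type — the first conjunct of `stub_printInputs`. Bookkeeping.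
[cite: Wuthrich2014, Thm. 16] [cite: CastellaGrossiSkinner2025, Prop. 3.4.2] [cite: KobayashiOta2020, Prop. 2.9] -/
theorem publishedAll_closed :
    PublishedFacts ∧ PublishedFactsII ∧
      CastellaGrossiSkinner2025.prop342_twoLineEulerChar_trivialChar ∧
      KobayashiOta2020.prop29_charIdeal_XGr_anticyclotomic_eq_of_isIsogenous :=
  stub_printInputs.1

/-- v11–v13's `stub_publishedFW` (PUB ×2), token-identical type — Ferrero–Washington from `stub_printInputs.2` and Iwasawa's «`μ = 0` ⟹
finitely many everywhere-unramified classes», now the TREE THEOREM `IwasawaTheory.classicalMuVanishes_finite_unramifiedClasses_holds`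
(`Literature/NumberTheory/IwasawaTheory/ClassicalMuVanishesUnramifiedClassesProofs.lean`, p694611 + exact-name alias). Bookkeeping.
[cite: FerreroWashington1979, Theorem] [cite: Lang1990, Ch. 5 §1 Thm. 1.2, §4 Thm. 4.4] [cite: Washington1997, §13.3, §13.5 (Prop. 13.28)] -/
theorem publishedFW_closed :
    IwasawaTheory.ferreroWashington1979_classicalMuVanishes ∧
      IwasawaTheory.classicalMuVanishes_finite_unramifiedClasses :=
  ⟨stub_printInputs.2, IwasawaTheory.classicalMuVanishes_finite_unramifiedClasses_holds⟩

/-- v12–v13's `stub_publishedL59` (Greenberg, LNM 1716, §5 **Lemma 5.9**, even finiteness clause over `ℚ_∞`), token-identical type — now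
the TREE THEOREM MODULO FERRERO–WASHINGTON `IwasawaTheory.greenberg1999_lemma59_even_finite_of_ferreroWashington`
(`Literature/NumberTheory/IwasawaTheory/GreenbergLemma59OfFerreroWashington.lean`, p717721, seat lam-a g20), fed by `stub_printInputs.2`.
[cite: Greenberg1999LNM, §5 Lemma 5.9 (pp. 142–144 of the volume)] [cite: FerreroWashington1979, Theorem] -/
theorem publishedL59_closed : IwasawaTheory.greenberg1999_lemma59_even_finite :=
  IwasawaTheory.greenberg1999_lemma59_even_finite_of_ferreroWashington stub_printInputs.2

/-- `stub_goodLatticeBDPValue` · the route's crux 2 BY NAME (item stmt-BirchSwinnertonDyer-19032; SAME WALL, declared).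
[cite: KellerYin2024, Thm. 3.0.8 (IMC2)] -/
theorem stub_goodLatticeBDPValue :
    Summit.BirchSwinnertonDyer.BirchSwinnertonDyer.Theses.EisensteinPrimes.GoodLatticeBDPValue := by
  sorry

/-- `stub_crossTransferSomeLattice` · M/L · THE PRE ATOM IN THE FORM XI° (`…Theorems.InterludeWithTorsion.CrossTransferAtSomeLattice`;
v13, RE-WORDED from v8–v12's XI″ `stub_fourTermSomeLattice`): the two DIVISIBILITY TRANSFERS of CGS Prop. 4.2.1 (`prop:equiv`,
Greenberg ⟺ ordinary main conjecture over `K_∞⁺`) at `α = 𝟙` at SOME member `V ∼ E` of the class with good reduction, reducible `V[p]`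
and (Heeg) (print: Wüthrich's `E_•`), NO `K`-torsion hypothesis — (⊇) `X_ord` torsion and `G₀ ∈ char X_ord(V/K_∞⁺)` ⟹
`(𝓛_Gr⁺) ⊆ char(X_Gr(V/K_∞⁺)) Λ^ur`; (⊆) `X_Gr` torsion and `char(X_Gr) Λ^ur ⊆ (𝓛_Gr⁺)` ⟹ `char X_ord(V/K_∞⁺) ⊆ (G₀)` — guarded by
PUB and PUB-II as before. PRE only through the rider `prop:equiv` ⇐ Cor. 4.1.3 ⇐ Thm. 4.1.1 ⇐ BSTW24 §5 (flag `CGS25-BST-Thm311`); the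
proof-level XI″ (four-term identities, [TF] in place of `E_•(K)[p] = 0`) IMPLIES this stub (`xi0Door_of_fourTermDoor`,
`crossTransferSome_of_fourTermSome`); carriers of either proof (Beilinson–Flach classes, Coleman maps, the explicit reciprocity laws) are
absent from the tree («NOT typable today», the tree's CGS Literature files).
[cite: CastellaGrossiSkinner2025, Prop. 4.2.1, Cor. 4.1.3, Thm. 4.1.1, §5 Steps 2–3] [cite: Kato2004Asterisque, §13.8]
[cite: BurungaleSkinnerTianWan2024, §5] -/
theorem stub_crossTransferSomeLattice : PublishedFacts → PublishedFactsII → CrossTransferAtSomeLattice := by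
  sorry

/-- **[Unr] CLOSED MODULO PUB (v11)** — v10's `stub_gl1InputUnramified : RoadBHelpers.GL1InputUnramified` (everywhere-unramified
classes of `H¹(K_∞, M)` finite for an order-`p` `M` with `Γ_ℚ`-provenance over the cyclotomic tower of an imaginary quadratic `K`) from the two
named facts of `stub_publishedFW` by the tree theorem `UnrTransport.gl1InputUnramified_of_ferreroWashington` (p692956 ⇐ p692713; ideator
bsd-idea-11 g17): the trivialising abelian field `F = K·ℚ(η)` (`IsAbelianGalois ℚ F`, `p ∤ [F : K] < p`), Ferrero–Washington for `F`,
`μ = 0 ⟹` finiteness over `F_∞`, and the transport `resField` back to `K_∞` (unramified ↦ unramified, finite fibres); non-continuous actions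
have `H¹ = 0`. [cite: FerreroWashington1979, Theorem] [cite: Washington1997, §13.5 (Prop. 13.28)] [cite: GreenbergLNM1716, §5, proof of Prop. 5.10] -/
theorem gl1InputUnramified_of_stubs : RoadBHelpers.GL1InputUnramified :=
  UnrTransport.gl1InputUnramified_of_ferreroWashington publishedFW_closed.1 publishedFW_closed.2

/-- **[Even] CLOSED MODULO PUB (v12)** — v10/v11's `stub_greenbergEvenInput` (W2's `hEven`: for some `τ ∈ Γ_ℚ ∖ res(Γ_K)`, the image
of `H¹(K_p/K_∞, M)` under `1 + T_τ` or `1 − T_τ` is finite, `T_τ = cycSwapH1`) from Greenberg's Lemma 5.9 over `ℚ_∞` (`stub_publishedL59`)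
by the tree theorem `EvenTransport.greenbergEvenInput_of_lemma59` (ideator bsd-idea-11 g17; `τ` = a complex conjugation; non-continuous
actions have `H¹ = 0`; `c₀` acts by `±1`; `+`: corestriction along the index-2 pair and Lemma 5.9 for `M`; `−`: the same for the EVEN twist
`M ⊗ ε_K`, whose swap is `−T_{c₀}`). [cite: Greenberg1999LNM, §5 Lemma 5.9] [cite: SerreGaloisCohomology1997, I §2.4] -/
theorem greenbergEvenInput_of_stubs :
    ∀ (K : Type) [Field K] [NumberField K] [IsGalois ℚ K], IsImaginaryQuadratic K →
      ∀ (p : ℕ) [Fact p.Prime], p ≠ 2 →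
      ∀ (κ : ZpExtension K p) (hκ : κ.IsCyclotomic),
      ∀ (M : Type) [AddCommGroup M] [DistribMulAction (absoluteGaloisGroup ℚ) M]
        [DistribMulAction (absoluteGaloisGroup K) M] [TopologicalSpace M] [DiscreteTopology M],
        Nat.card M = p →
        ∀ (hM : ∀ (σ : absoluteGaloisGroup K) (m : M), σ • m = (absGaloisRestrict ℚ K σ) • m),
        ∃ τ : absoluteGaloisGroup ℚ, τ ∉ Set.range (absGaloisRestrict ℚ K) ∧
          (((fun c ↦ c + cycSwapH1 κ hκ M hM τ c) ''
              (unramifiedOutside κ.kerSubgroup M p ∅ : Set (subgroupH1 κ.kerSubgroup M))).Finite ∨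
            ((fun c ↦ c - cycSwapH1 κ hκ M hM τ c) ''
              (unramifiedOutside κ.kerSubgroup M p ∅ : Set (subgroupH1 κ.kerSubgroup M))).Finite) :=
  EvenTransport.greenbergEvenInput_of_lemma59 publishedL59_closed

/-! ## Closed by name (tree theorems; no `sorry` below this line) -/

/-- **(B3) `ResidualGL1FinitenessOdd` FROM [Unr] ∧ [Even] (v10; v8/v9's `stub_residualGL1FinitenessOdd` SPLIT)** — by W2's tree
theorem `residualGL1FinitenessOdd_of_unr_even'` (`Theorems/…InterludeResidualGL1Tame.lean`, p690082: the complex-conjugation swap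
carries the strict condition from `v̄` to `v`, the intersection of the two Selmer groups is everywhere-unramified, the tame places are a
theorem, `S`-imprimitivity), fed by [Unr] (`gl1InputUnramified_of_stubs`, read through `RoadBHelpers.mem_everywhereUnramified_iff`) and
[Even] (`greenbergEvenInput_of_stubs`). [cite: GreenbergLNM1716, §5, Lemma 5.9 and proof of Prop. 5.10] [cite: FerreroWashington1979, Theorem] -/
theorem residualGL1FinitenessOdd_of_stubs : ResidualGL1FinitenessOdd :=
  residualGL1FinitenessOdd_of_unr_even'
    (fun K _ _ hK p _ hp2 κ hκ M _ _ _ _ _ hcard hprov ↦ by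
      have h := gl1InputUnramified_of_stubs K hK p hp2 κ hκ M hcard hprov
      refine h.subset ?_
      intro c hc
      exact (RoadBHelpers.mem_everywhereUnramified_iff (H := κ.kerSubgroup) (M := M) c).2 hc)
    greenbergEvenInput_of_stubs

/-- `stub_roadBResidueP` of v8 · road B (B1c) at degree exactly `p` — CLOSED since v9 by the tree theorem
`…Theorems.InterludeWithTorsion.stub_roadBResidueP` (p687195 ⇐ p687054/p686588; stub-worker W1 over the ideator's companion §Core).
Re-exported here for the record of the line. [cite: GreenbergLNM1716, §5, proof of Prop. 5.10] -/
theorem stub_roadBResidueP : RoadBResidueP :=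
  Summit.BirchSwinnertonDyer.BirchSwinnertonDyer.Theorems.InterludeWithTorsion.stub_roadBResidueP

/-- **Composition of the line from its stubs ⟹ crux 5 `MazurMCOnX1RankZero`, BY NAME** (v14 = v13 with the PUB bundle read from the cite stub): the tree theorem
`…Theorems.InterludeWithTorsion.mazurMCOnX1RankZero_of_stubs_xi0` (`Theorems/…InterludeCoreDescentXI0.lean` over
`…InterludeCoreDescent.lean` p686428: frame ⊕ S1⁺⊕GV ⊕ XI° ⊕ K2⁺ (K2⁺-e proved ⊕ road B) ⊕ ISO ⊕ Steps 2–3 core ⊕ the descent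
`K_∞⁺ → ℚ_∞`) applied to the PUB bundle, crux 2, the XI° door, (B3) recomposed from [Unr] ∧ [Even] (both CLOSED MODULO PUB), and the
closed (B1c). [cite: CastellaGrossiSkinner2025, §5 (Interlude), Prop. 4.2.1] [cite: KellerYin2024, Thm. 3.0.8]
[cite: GreenbergLNM1716, §5 Lemma 5.9, Prop. 5.10] -/
theorem MazurMCOnX1RankZero_of :
    Summit.BirchSwinnertonDyer.BirchSwinnertonDyer.Theses.EisensteinPrimes.MazurMCOnX1RankZero :=
  mazurMCOnX1RankZero_of_stubs_xi0 publishedAll_closed stub_goodLatticeBDPValue stub_crossTransferSomeLattice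
    residualGL1FinitenessOdd_of_stubs stub_roadBResidueP

end Summit.BirchSwinnertonDyer.BirchSwinnertonDyer.Cruxes.MazurMCOnX1RankZero.InterludeWithTorsion

end
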